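import Mathlib
import HarnessLib
import Literature.Analysis.FluidPDE.SpaceTimeParametricIntegral
import Literature.Analysis.FunctionSpaces.SmoothParametricIntegral
import Summits.NavierStokesRegularity.NavierStokesRegularity.Theorems.PoloidalWindowDoorPoloidalWindowRigidityWindow
import Summits.NavierStokesRegularity.NavierStokesRegularity.Theorems.AxisTwistDoorAveragedConeLiouvilleCylFrame

/-!
# Route `AxisTwistDoor`, crux `AveragedConeLiouville` (stmt-NavierStokesRegularity-26889) — stub `stub_circleToolkit`
# of the skeleton of record `lrt_shell` (registered signature `CircleToolkit`, VERBATIM from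
# `Theorems/AxisTwistDoorAveragedConeLiouvilleDefs.lean`)

The CIRCLE TOOLKIT: everything elementary about the circle functionals of the line that is not the swirl identity.
For a profile `v` of the route's energy class (`InClass C v π H`: Type-I time rate, continuity, unit-viscosity
Oseen–Duhamel identity, divergence-free slices, suitable weak with a weak gradient and `𝐈 < ∞`) the axis circulation
`Γ(r,z,s) = ∮_{S(r,z)} v(s)·e_θ dl = ∫₀^{2π} ⟪v(s)(r cos θ, r sin θ, z), e_θ⟫ r dθ` (`circ`) satisfies:

* (a) `Γ` is `C²` (indeed `C^∞`) in `(r, z, s)` on `s < 0` — the class is jointly smooth on the open lower slab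
  (KNSS 2009 Prop. 4.1 via the tree's `isTypeIAncientMild_of_class`), and a parametric integral over a compact
  interval of a smooth integrand is smooth (tree: `contDiffOn_parametric_intervalIntegral_prod`);
* (b) `Γ(0, z, s) = 0`;
* (c) `∂_zΓ = −∮ ω_r dl` (`radVortCirc`): differentiate under the integral sign
  (`hasFDerivAt_parametric_intervalIntegral`) and use the pointwise identity
  `ω_r r = ∂_θ v₃ − r ⟪Dv e₃, e_θ⟫` along the circle (`inner_curl_eR_mul`), the `θ`-derivative integrating to
  zero over the period (frame calculus in `…AveragedConeLiouvilleCylFrame.lean`);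
* (d) under the sign `ω₃ ≥ 0` (`SignE3`) and a bound `|v(s)| ≤ B` on the circle `S(r,z)`: LRT's circle term
  `∮(v_r ω₃ − ω_r v₃) dl` (`circleTerm`, Lei–Ren–Tian arXiv:2501.08976 eq. Gamma-30) obeys the ONE-SIDED SHELL
  INEQUALITY `|∮(v_r ω₃ − ω_r v₃) dl| ≤ B(∮ω₃ dl + ∮|ω_h| dl)` (pointwise `|v_r| , |v₃| ≤ B`, `ω₃ ≥ 0`,
  `|ω_r| ≤ |ω_h|`), and `|Γ| ≤ 2π r B` — the two ingredients of eq. Gamma-34 on the regular shell and of the free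
  flux upper bound of the line.

Seat ns-atd-p1 (LEAD of route AxisTwistDoor, KEY-NS #104/#111). WHAT THIS IS NOT: not a statement about Navier–Stokes
regularity — calculus for a STAGED door route on the leaf `HalfSpaceWindowDoor.Target`; the crux
`AveragedConeLiouville`, the leaf and NS regularity remain OPEN. Lands `--supports` the crux item.
-/

noncomputable section

-- the summit and its single sub-problem share the name (CONVENTIONS §1), as in every Theorems file
set_option linter.dupNamespace false

namespace Summit.NavierStokesRegularity.NavierStokesRegularity.Theorems.AxisTwistDoorAveragedConeLiouvilleCircleToolkit

open scoped BigOperators Topology InnerProductSpace ContDiff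
open Filter Set Function MeasureTheory Metric intervalIntegral
open Literature.Analysis
open Literature.Analysis.FluidPDE hiding eR
open Summit.NavierStokesRegularity.NavierStokesRegularity.Theorems.AxisTwistDoorAveragedConeLiouvilleDefs
open Summit.NavierStokesRegularity.NavierStokesRegularity.Theorems.AxisTwistDoorAveragedConeLiouvilleCylFrame
open Summit.NavierStokesRegularity.NavierStokesRegularity.Theorems.AveragedConeLiouville.CircleStokes
  (inner_e3 cylPt_two_pi continuous_eR continuous_eT hasDerivAt_cylPt_theta)
open Summit.NavierStokesRegularity.NavierStokesRegularity.Theorems.PoloidalWindowDoorPoloidalWindowRigidityWindow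
  (isTypeIAncientMild_of_class)

/-! ### Regularity of class profiles -/

variable {C : ℝ} {v : ℝ → EuclideanSpace ℝ (Fin 3) → EuclideanSpace ℝ (Fin 3)}
  {π : ℝ → EuclideanSpace ℝ (Fin 3) → ℝ}
  {H : ℝ → EuclideanSpace ℝ (Fin 3) → EuclideanSpace ℝ (Fin 3) →L[ℝ] EuclideanSpace ℝ (Fin 3)}

/-- A class profile is jointly smooth on the open lower slab. -/
theorem smooth_of_class (h : InClass C v π H) : ContDiffOn ℝ ∞ (uncurry v) (Iio (0 : ℝ) ×ˢ univ) :=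
  (isTypeIAncientMild_of_class h.decay h.cont h.mild h.divFree).contDiffOn

/-- The slices `v s`, `s < 0`, of a class profile are smooth. -/
theorem contDiff_slice (h : InClass C v π H) {s : ℝ} (hs : s < 0) : ContDiff ℝ ∞ (v s) :=
  IsSmoothSpaceTimeOn.contDiff_slice (isTypeIAncientMild_of_class h.decay h.cont h.mild h.divFree).contDiffOn hs

/-- The vorticity slice `curl (v s)` of a class profile is continuous. -/
theorem continuous_curl_slice (h : InClass C v π H) {s : ℝ} (hs : s < 0) : Continuous (curl (v s)) := by
  have h1 : ContDiff ℝ 1 (v s) := (contDiff_slice h hs).of_le (by exact_mod_cast le_top)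
  have hD : Continuous (fderiv ℝ (v s)) := h1.continuous_fderiv one_ne_zero
  have e : curl (v s) = fun x => curlCLM (fderiv ℝ (v s) x) := by
    funext x; exact curl_eq_curlCLM (v s) x
  rw [e]
  exact curlCLM.continuous.comp hD

/-! ### (a) joint smoothness of `Γ` -/

/-- The integrand of `Γ` as a function of `(θ, (s, (r, z)))` is smooth within `univ × ((−∞,0) × univ)`. -/
theorem contDiffOn_integrand (h : InClass C v π H) :
    ContDiffOn ℝ ∞ (fun w : ℝ × (ℝ × (ℝ × ℝ)) => ⟪v w.2.1 (cylPt w.2.2.1 w.1 w.2.2.2), eT w.1⟫_ℝ * w.2.2.1)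
      (univ ×ˢ (Iio (0 : ℝ) ×ˢ univ)) := by
  have hg : ContDiff ℝ ∞ fun w : ℝ × (ℝ × (ℝ × ℝ)) => ((w.2.1, cylPt w.2.2.1 w.1 w.2.2.2) :
      ℝ × EuclideanSpace ℝ (Fin 3)) :=
    (contDiff_fst.comp contDiff_snd).prodMk
      (contDiff_cylPt_comp (contDiff_fst.comp (contDiff_snd.comp contDiff_snd)) contDiff_fst
        (contDiff_snd.comp (contDiff_snd.comp contDiff_snd)))
  have hmaps : MapsTo (fun w : ℝ × (ℝ × (ℝ × ℝ)) => ((w.2.1, cylPt w.2.2.1 w.1 w.2.2.2) :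
      ℝ × EuclideanSpace ℝ (Fin 3))) (univ ×ˢ (Iio (0 : ℝ) ×ˢ univ)) (Iio (0 : ℝ) ×ˢ univ) := by
    intro w hw
    simp only [mem_prod, mem_univ, mem_Iio, true_and, and_true] at hw ⊢
    exact hw
  have hv : ContDiffOn ℝ ∞ (fun w : ℝ × (ℝ × (ℝ × ℝ)) => v w.2.1 (cylPt w.2.2.1 w.1 w.2.2.2))
      (univ ×ˢ (Iio (0 : ℝ) ×ˢ univ)) :=
    (smooth_of_class h).comp hg.contDiffOn hmaps
  exact (hv.inner ℝ (contDiff_eT_comp contDiff_fst).contDiffOn).mul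
    (contDiff_fst.comp (contDiff_snd.comp contDiff_snd)).contDiffOn

/-- `Γ` is `C^∞`, hence `C²`, in `(r, z, s)` on `s < 0`. -/
theorem contDiffOn_circ (h : InClass C v π H) :
    ContDiffOn ℝ 2 (fun q : ℝ × ℝ × ℝ => circ v q.1 q.2.1 q.2.2) {q | q.2.2 < 0} := by
  have hI : ContDiffOn ℝ ∞ (fun p : ℝ × (ℝ × ℝ) => ∫ θ in (0 : ℝ)..(2 * Real.pi),
      (fun w : ℝ × (ℝ × (ℝ × ℝ)) => ⟪v w.2.1 (cylPt w.2.2.1 w.1 w.2.2.2), eT w.1⟫_ℝ * w.2.2.1) (θ, p))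
      (Iio (0 : ℝ) ×ˢ (univ : Set (ℝ × ℝ))) :=
    contDiffOn_parametric_intervalIntegral_prod (convex_Iio 0)
      (by rw [interior_Iio]; exact ⟨-1, by norm_num⟩) (contDiffOn_integrand h) _ _
  -- reshuffle the parameters `(r, z, s) ↦ (s, (r, z))`
  have hσ : ContDiff ℝ ∞ fun q : ℝ × ℝ × ℝ => ((q.2.2, (q.1, q.2.1)) : ℝ × (ℝ × ℝ)) :=
    (contDiff_snd.comp contDiff_snd).prodMk (contDiff_fst.prodMk (contDiff_fst.comp contDiff_snd))
  have hmaps : MapsTo (fun q : ℝ × ℝ × ℝ => ((q.2.2, (q.1, q.2.1)) : ℝ × (ℝ × ℝ))) {q | q.2.2 < 0}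
      (Iio (0 : ℝ) ×ˢ (univ : Set (ℝ × ℝ))) := by
    intro q hq
    exact mem_prod.2 ⟨hq, mem_univ _⟩
  have h2 : ((2 : ℕ) : WithTop ℕ∞) ≤ ∞ := WithTop.coe_le_coe.2 le_top
  have hc := (hI.comp hσ.contDiffOn hmaps).of_le h2
  refine hc.congr fun q _ => ?_
  rfl

/-! ### (b) the axis -/

/-- `Γ(0, z, s) = 0`. -/
theorem circ_zero (v : ℝ → EuclideanSpace ℝ (Fin 3) → EuclideanSpace ℝ (Fin 3)) (z s : ℝ) :
    circ v 0 z s = 0 := by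
  simp [circ]

/-! ### (c) the `z`-derivative of `Γ` -/

/-- **`∂_z Γ = −∮ ω_r dl`** for a smooth slice: the `z`-derivative of the circulation. -/
theorem hasDerivAt_circ_z (h : InClass C v π H) {s : ℝ} (hs : s < 0) (r z : ℝ) :
    HasDerivAt (fun z' => circ v r z' s) (-radVortCirc v r z s) z := by
  have hu : ContDiff ℝ ∞ (v s) := contDiff_slice h hs
  have hu1 : ContDiff ℝ 1 (v s) := hu.of_le (by exact_mod_cast le_top)
  have hd : Differentiable ℝ (v s) := hu1.differentiable one_ne_zero
  -- the smooth integrand `Hz (θ, z') = ⟪v s (cylPt r θ z'), e_θ⟫ r` on `ℝ × ℝ`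
  set Hz : ℝ × ℝ → ℝ := fun w => ⟪v s (cylPt r w.1 w.2), eT w.1⟫_ℝ * r with hHz
  have hH : ContDiff ℝ ∞ Hz :=
    ((hu.comp (contDiff_cylPt_comp contDiff_const contDiff_fst contDiff_snd)).inner ℝ
      (contDiff_eT_comp contDiff_fst)).mul contDiff_const
  have hinf : (∞ : WithTop ℕ∞) ≠ 0 := by simp
  -- one derivative under the integral sign
  have hF := Literature.Analysis.FunctionSpaces.hasFDerivAt_parametric_intervalIntegral hH hinf 0 (2 * Real.pi) z
  have hF' := hF.hasDerivAt
  have hcirc : (fun z' => circ v r z' s) = fun p : ℝ => ∫ σ in (0 : ℝ)..(2 * Real.pi), Hz (σ, p) := by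
    funext z'; rfl
  rw [hcirc]
  -- identify the derivative
  have hpt : ∀ θ : ℝ, fderiv ℝ Hz (θ, z) ((0 : ℝ), (1 : ℝ)) =
      ⟪fderiv ℝ (v s) (cylPt r θ z) e3, eT θ⟫_ℝ * r := by
    intro θ
    have h1 : HasDerivAt (fun q : ℝ => Hz (θ, q)) (fderiv ℝ Hz (θ, z) ((0 : ℝ), (1 : ℝ))) z := by
      have h := (Literature.Analysis.FunctionSpaces.hasFDerivAt_comp_prodMk hH hinf θ z).hasDerivAt
      simpa using h
    have h2 : HasDerivAt (fun q : ℝ => Hz (θ, q)) (⟪fderiv ℝ (v s) (cylPt r θ z) e3, eT θ⟫_ℝ * r) z := by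
      have h := ((hasDerivAt_slice_comp_cylPt_z hd r θ z).inner ℝ (hasDerivAt_const z (eT θ))).mul_const r
      simpa [hHz] using h
    exact h1.unique h2
  have hcontD : Continuous fun θ : ℝ => (fderiv ℝ Hz (θ, z)).comp (ContinuousLinearMap.inr ℝ ℝ ℝ) :=
    ((ContinuousLinearMap.compL ℝ ℝ (ℝ × ℝ) ℝ).flip (ContinuousLinearMap.inr ℝ ℝ ℝ)).continuous.comp
      ((hH.continuous_fderiv hinf).comp (continuous_id.prodMk continuous_const))
  have hval : (∫ σ in (0 : ℝ)..(2 * Real.pi), (fderiv ℝ Hz (σ, z)).comp (ContinuousLinearMap.inr ℝ ℝ ℝ)) 1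
      = -radVortCirc v r z s := by
    rw [ContinuousLinearMap.intervalIntegral_apply (hcontD.intervalIntegrable _ _)]
    have e1 : (fun σ : ℝ => ((fderiv ℝ Hz (σ, z)).comp (ContinuousLinearMap.inr ℝ ℝ ℝ)) (1 : ℝ)) =
        fun σ => fderiv ℝ (v s) (cylPt r σ z) (r • eT σ) 2 - ⟪curl (v s) (cylPt r σ z), eR σ⟫_ℝ * r := by
      funext σ
      rw [ContinuousLinearMap.comp_apply, ContinuousLinearMap.inr_apply, hpt σ, inner_curl_eR_mul]
      ring
    rw [e1]
    have hc1 : Continuous fun σ : ℝ => fderiv ℝ (v s) (cylPt r σ z) (r • eT σ) 2 := by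
      have hD : Continuous (fderiv ℝ (v s)) := hu1.continuous_fderiv one_ne_zero
      have h1 : Continuous fun σ => fderiv ℝ (v s) (cylPt r σ z) (r • eT σ) :=
        (hD.comp (continuous_cylPt_θ r z)).clm_apply (continuous_eT.const_smul r)
      exact (EuclideanSpace.proj (2 : Fin 3) : EuclideanSpace ℝ (Fin 3) →L[ℝ] ℝ).continuous.comp h1
    have hc2 : Continuous fun σ : ℝ => ⟪curl (v s) (cylPt r σ z), eR σ⟫_ℝ * r :=
      (((continuous_curl_slice h hs).comp (continuous_cylPt_θ r z)).inner continuous_eR).mul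
        continuous_const
    rw [intervalIntegral.integral_sub (hc1.intervalIntegrable _ _) (hc2.intervalIntegrable _ _),
      integral_fderiv_tangent_apply_two hu1 r z, zero_sub]
    rfl
  rw [hval] at hF'
  exact hF'

/-! ### (d) the shell inequalities -/

/-- **The one-sided shell inequality** `|∮(v_r ω₃ − ω_r v₃) dl| ≤ B(∮ω₃ dl + ∮|ω_h| dl)` when `|v(s)| ≤ B` on the
circle and `ω₃ ≥ 0`. -/
theorem abs_circleTerm_le (h : InClass C v π H) (hsign : SignE3 v) {s r z B : ℝ} (hs : s < 0) (hr : 0 < r)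
    (hB : ∀ θ : ℝ, ‖v s (cylPt r θ z)‖ ≤ B) :
    |circleTerm v r z s| ≤ B * (vortCirc v r z s + tiltCirc v r z s) := by
  have hvc : Continuous fun θ => v s (cylPt r θ z) :=
    (contDiff_slice h hs).continuous.comp (continuous_cylPt_θ r z)
  have hωc : Continuous fun θ => curl (v s) (cylPt r θ z) :=
    (continuous_curl_slice h hs).comp (continuous_cylPt_θ r z)
  have hf : Continuous fun θ => (⟪v s (cylPt r θ z), eR θ⟫_ℝ * ⟪curl (v s) (cylPt r θ z), e3⟫_ℝ
      - ⟪curl (v s) (cylPt r θ z), eR θ⟫_ℝ * ⟪v s (cylPt r θ z), e3⟫_ℝ) * r :=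
    (((hvc.inner continuous_eR).mul (hωc.inner continuous_const)).sub
      ((hωc.inner continuous_eR).mul (hvc.inner continuous_const))).mul continuous_const
  have hg1 : Continuous fun θ => ⟪curl (v s) (cylPt r θ z), e3⟫_ℝ * r :=
    (hωc.inner continuous_const).mul continuous_const
  have hg2 : Continuous fun θ => ‖curl (v s) (cylPt r θ z) - ⟪curl (v s) (cylPt r θ z), e3⟫_ℝ • e3‖ * r :=
    ((continuous_horizontal.comp hωc).norm).mul continuous_const
  exact abs_integral_le_const_mul_add hf hg1 hg2 fun θ =>
    abs_circleTerm_integrand_le (v s (cylPt r θ z)) (curl (v s) (cylPt r θ z)) hr.le (hB θ)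
      (hsign s hs (cylPt r θ z))

/-- **The free flux bound** `|Γ(r,z,s)| ≤ 2π r B` when `|v(s)| ≤ B` on the circle `S(r,z)`. -/
theorem abs_circ_le {v : ℝ → EuclideanSpace ℝ (Fin 3) → EuclideanSpace ℝ (Fin 3)} {s r z B : ℝ} (hr : 0 < r)
    (hB : ∀ θ : ℝ, ‖v s (cylPt r θ z)‖ ≤ B) :
    |circ v r z s| ≤ 2 * Real.pi * r * B := by
  have h2π : (0 : ℝ) ≤ 2 * Real.pi := by positivity
  unfold circ
  have hbound : ∀ θ ∈ Set.uIoc (0 : ℝ) (2 * Real.pi), ‖⟪v s (cylPt r θ z), eT θ⟫_ℝ * r‖ ≤ B * r := by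
    intro θ _
    rw [Real.norm_eq_abs, abs_mul, abs_of_pos hr]
    exact mul_le_mul_of_nonneg_right ((abs_inner_eT_le _ θ).trans (hB θ)) hr.le
  have h := intervalIntegral.norm_integral_le_of_norm_le_const hbound
  rw [Real.norm_eq_abs, sub_zero, abs_of_nonneg h2π] at h
  calc |∫ θ in (0 : ℝ)..(2 * Real.pi), ⟪v s (cylPt r θ z), eT θ⟫_ℝ * r| ≤ B * r * (2 * Real.pi) := h
    _ = 2 * Real.pi * r * B := by ring

/-! ### The stub -/

/-- **Stub `stub_circleToolkit` of the skeleton of record `lrt_shell` (crux `AveragedConeLiouville`,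
stmt-NavierStokesRegularity-26889), registered signature `CircleToolkit` VERBATIM**: for a profile of the route's energy
class, the axis circulation `Γ = ∮ v·e_θ dl` is `C²` in `(r,z,s)` on `s < 0`, vanishes on the axis, has
`∂_zΓ = −∮ω_r dl`, and — under the sign `ω₃ ≥ 0` and a bound `|v(s)| ≤ B` on the circle — LRT's circle term obeys
`|∮(v_r ω₃ − ω_r v₃) dl| ≤ B(∮ω₃ dl + ∮|ω_h| dl)` and `|Γ| ≤ 2πrB`. -/
theorem stub_circleToolkit : CircleToolkit := by
  intro C v π H hcl
  refine ⟨contDiffOn_circ hcl, fun s _ z => circ_zero v z s, fun s hs r _ z => hasDerivAt_circ_z hcl hs r z,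
    fun hsign s r z B hs hr hB => ⟨abs_circleTerm_le hcl hsign hs hr hB, abs_circ_le hr hB⟩⟩

end Summit.NavierStokesRegularity.NavierStokesRegularity.Theorems.AxisTwistDoorAveragedConeLiouvilleCircleToolkit

end
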